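import Summits.HubbardSuperconductivity.HubbardSuperconductivity.Theorems.SoloBlindVariationalCrutch
import Literature.MathematicalPhysics.QuantumLattice.PairFieldYangCeiling
import Literature.MathematicalPhysics.QuantumLattice.PairFieldPairedVectors
import HarnessLib

/-!
# Vertical dimers on the even torus (solo-blind programme, Theorem 33 — geometry)

Combinatorial geometry of the Gutzwiller dimer condensate of `SoloBlindDimerCondensate`.
On an even torus `(ℤ/L)²` a site `k` is a *slot* if its second coordinate is even (`dimerSlots`;
`2 · #slots = L²`, `two_mul_card_dimerSlots`); the *vertical dimer* at `k` occupies the orbitals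
`(k,↓)` and `(k+e₂,↑)`, and a set `S` of slots carries the occupation set `dimerConfig S`.

The one structural fact: in the Jordan–Wigner (lexicographic, site-major) order of the fermionic
torus `FermionTorus 2 L = Lex (Fin 2 → Fin L)` with orbitals `Orb = Lex (site × spin)`, the up
orbital `(k+e₂,↑)` of a slot `k` is the SUCCESSOR of its down orbital `(k,↓)`
(`dn_lt_iff_up_le`; no wrap-around because `k₂` is even and `L` is even), so the two fermion
operators of a dimer never see a sign string between them (`jwSign_up_eq_jwSign_dn`).  Besides:
membership / insertion / injectivity bookkeeping for `dimerConfig`, and the Gutzwiller constraint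
(`not_double`: no site of a dimer configuration over slots is doubly occupied, since `k ± e₂` is
never a slot when `k` is). [this work; elementary]
-/

noncomputable section

namespace Summit.HubbardSuperconductivity.HubbardSuperconductivity.Theorems.DimerCondensate

open Matrix Finset Literature.Probability.LatticeModels Literature.MathematicalPhysics.QuantumLattice
  Literature.MathematicalPhysics.QuantumLattice.EigenvalueContinuation
open scoped ComplexOrder ComplexConjugate

variable {L : ℕ} [NeZero L]

/-- Torus sites are compared through the linear order: this pins `DecidableEq (FermionTorus 2 L)`
(hence `insert`/`image` on orbital configurations) to the instance carried by the orbital-generic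
tree lemmas (`annihilation_apply`, `jwSign_insert_of_lt`, …), as in `DopedRVBState`. [folklore] -/
local instance (priority := high) instDecidableEqFermionTorusDimer : DecidableEq (FermionTorus 2 L) :=
  LinearOrder.toDecidableEq

/-- The vertical unit step `e₂ = (0, 1)` of `ℤ²` (literal term). -/
local notation "𝐞" => (Pi.single 1 1 : Site 2)

/-- The down orbital `(k, ↓)` of the vertical dimer at `k`. -/
local notation "D[" k "]" => (orb (FermionTorus.ofTorusSite k) 1)

/-- The up orbital `(k + e₂, ↑)` of the vertical dimer at `k`. -/
local notation "U[" k "]" => (orb (FermionTorus.ofTorusSite (k + Torus.proj L 𝐞)) 0)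

/-! ### The fermionic torus order: `(k+e₂, ↑)` is the successor of `(k, ↓)` -/

omit [NeZero L] in
/-- The lexicographic order of the fermionic torus in coordinates. [folklore] -/
theorem fermionTorus_lt_iff (x y : FermionTorus 2 L) :
    x < y ↔ ofLex x 0 < ofLex y 0 ∨ (ofLex x 0 = ofLex y 0 ∧ ofLex x 1 < ofLex y 1) := by
  change (∃ i, (∀ j, j < i → ofLex x j = ofLex y j) ∧ ofLex x i < ofLex y i) ↔ _
  simp [Fin.exists_fin_two, Fin.forall_fin_two]

omit [NeZero L] in
/-- Equality on the fermionic torus in coordinates. [folklore] -/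
theorem fermionTorus_eq_iff (x y : FermionTorus 2 L) :
    x = y ↔ ofLex x 0 = ofLex y 0 ∧ ofLex x 1 = ofLex y 1 := by
  constructor
  · rintro rfl; exact ⟨rfl, rfl⟩
  · rintro ⟨h0, h1⟩
    exact ofLex.injective (funext fun i => by fin_cases i <;> assumption)

/-- The dimer slots: sites whose second coordinate is even. -/
def dimerSlots (L : ℕ) [NeZero L] : Finset (TorusSite 2 L) :=
  univ.filter fun k : TorusSite 2 L => (k 1).val % 2 = 0

/-- Membership in the slot set. [folklore] -/
theorem mem_dimerSlots {k : TorusSite 2 L} : k ∈ dimerSlots L ↔ (k 1).val % 2 = 0 := by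
  simp [dimerSlots]

omit [NeZero L] in
/-- Second coordinate of `k + e₂`. [folklore] -/
theorem add_e2_apply_one (k : TorusSite 2 L) : (k + Torus.proj L 𝐞) 1 = k 1 + 1 := by
  simp [Torus.proj_apply]

omit [NeZero L] in
/-- First coordinate of `k + e₂`. [folklore] -/
theorem add_e2_apply_zero (k : TorusSite 2 L) : (k + Torus.proj L 𝐞) 0 = k 0 := by
  simp [Torus.proj_apply]

/-- A positive even side is at least `2`. [folklore] -/
theorem two_le_of_even (hL : Even L) : 2 ≤ L := by
  have h0 : L ≠ 0 := NeZero.ne L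
  obtain ⟨r, hr⟩ := hL
  omega

/-- `(k₂ + 1).val = k₂.val + 1` on a slot of an even torus (no wrap-around). [folklore] -/
theorem val_add_one_of_mem (hL : Even L) {k : TorusSite 2 L} (hk : k ∈ dimerSlots L) :
    (k 1 + 1).val = (k 1).val + 1 := by
  haveI : Fact (1 < L) := ⟨lt_of_lt_of_le one_lt_two (two_le_of_even hL)⟩
  have hlt := ZMod.val_lt (k 1)
  rw [mem_dimerSlots] at hk
  obtain ⟨r, hr⟩ := hL
  rw [ZMod.val_add, ZMod.val_one, Nat.mod_eq_of_lt (by omega)]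

/-- The partner site `k + e₂` of a slot is not a slot. [folklore] -/
theorem add_e2_not_mem (hL : Even L) {k : TorusSite 2 L} (hk : k ∈ dimerSlots L) :
    k + Torus.proj L 𝐞 ∉ dimerSlots L := by
  have h := val_add_one_of_mem hL hk
  rw [mem_dimerSlots] at hk ⊢
  rw [add_e2_apply_one, h]
  omega

/-- Conversely the partner of a non-slot is a slot (even side). [folklore] -/
theorem add_e2_mem_of_not_mem (hL : Even L) {k : TorusSite 2 L} (hk : k ∉ dimerSlots L) :
    k + Torus.proj L 𝐞 ∈ dimerSlots L := by
  haveI : Fact (1 < L) := ⟨lt_of_lt_of_le one_lt_two (two_le_of_even hL)⟩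
  have hlt := ZMod.val_lt (k 1)
  rw [mem_dimerSlots] at hk ⊢
  rw [add_e2_apply_one, ZMod.val_add, ZMod.val_one]
  obtain ⟨r, hr⟩ := hL
  rcases Nat.lt_or_ge ((k 1).val + 1) L with h | h
  · rw [Nat.mod_eq_of_lt h]; omega
  · have hE : (k 1).val + 1 = L := by omega
    rw [hE, Nat.mod_self]

/-- `k - e₂` is not a slot if `k` is. [folklore] -/
theorem sub_e2_not_mem (hL : Even L) {k : TorusSite 2 L} (hk : k ∈ dimerSlots L) :
    k - Torus.proj L 𝐞 ∉ dimerSlots L := by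
  intro h
  have := add_e2_not_mem hL h
  rw [sub_add_cancel] at this
  exact this hk

/-- The torus has `L²` sites. [folklore] -/
theorem card_torusSite : Fintype.card (TorusSite 2 L) = L ^ 2 := by
  simp [Fintype.card_pi, ZMod.card]

/-- **Half of the sites are slots**: `2 · #slots = L²` on an even torus (`k ↦ k + e₂` exchanges
slots and non-slots). [folklore] -/
theorem two_mul_card_dimerSlots (hL : Even L) : 2 * (dimerSlots L).card = L ^ 2 := by
  have h1 : (dimerSlots L).card ≤ ((dimerSlots L)ᶜ).card :=
    Finset.card_le_card_of_injOn (fun k => k + Torus.proj L 𝐞)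
      (fun k hk => Finset.mem_compl.2 (add_e2_not_mem hL hk))
      (fun a _ b _ h => add_right_cancel h)
  have h2 : ((dimerSlots L)ᶜ).card ≤ (dimerSlots L).card :=
    Finset.card_le_card_of_injOn (fun k => k + Torus.proj L 𝐞)
      (fun k hk => add_e2_mem_of_not_mem hL (Finset.mem_compl.1 hk))
      (fun a _ b _ h => add_right_cancel h)
  have h3 := Finset.card_add_card_compl (dimerSlots L)
  rw [card_torusSite] at h3
  omega

/-- The up site `k + e₂` of a slot is the successor of the down site `k` in the Jordan–Wigner
(lexicographic) order of the fermionic torus: `(k,↓) < o ↔ (k+e₂,↑) ≤ o`. [folklore] -/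
theorem dn_lt_iff_up_le (hL : Even L) {k : TorusSite 2 L} (hk : k ∈ dimerSlots L)
    (o : Orb (FermionTorus 2 L)) : D[k] < o ↔ U[k] ≤ o := by
  have h1 : ((ofLex (FermionTorus.ofTorusSite (k + Torus.proj L 𝐞)) 1 : Fin L) : ℕ) =
      ((ofLex (FermionTorus.ofTorusSite k) 1 : Fin L) : ℕ) + 1 := by
    rw [FermionTorus.ofLex_ofTorusSite_apply, FermionTorus.ofLex_ofTorusSite_apply, add_e2_apply_one,
      val_add_one_of_mem hL hk]
  have h0 : ((ofLex (FermionTorus.ofTorusSite (k + Torus.proj L 𝐞)) 0 : Fin L) : ℕ) =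
      ((ofLex (FermionTorus.ofTorusSite k) 0 : Fin L) : ℕ) := by
    rw [FermionTorus.ofLex_ofTorusSite_apply, FermionTorus.ofLex_ofTorusSite_apply, add_e2_apply_zero]
  have hσ : ¬ (1 : Fin 2) < (ofLex o).2 := not_lt.2 (Fin.le_last _)
  have hσ' : (0 : Fin 2) ≤ (ofLex o).2 := Fin.zero_le _
  rw [Prod.Lex.lt_iff, Prod.Lex.le_iff]
  simp only [ofLex_toLex, hσ, and_false, or_false, hσ', and_true]
  rw [fermionTorus_lt_iff, fermionTorus_lt_iff, fermionTorus_eq_iff]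
  simp only [Fin.lt_def, Fin.ext_iff, h0, h1]
  omega

/-- `(k,↓) < (k+e₂,↑)`. [folklore] -/
theorem dn_lt_up (hL : Even L) {k : TorusSite 2 L} (hk : k ∈ dimerSlots L) : D[k] < U[k] :=
  (dn_lt_iff_up_le hL hk _).2 le_rfl

/-- `o < (k+e₂,↑) ↔ o ≤ (k,↓)`. [folklore] -/
theorem lt_up_iff_le_dn (hL : Even L) {k : TorusSite 2 L} (hk : k ∈ dimerSlots L)
    (o : Orb (FermionTorus 2 L)) : o < U[k] ↔ o ≤ D[k] := by
  rw [← not_le, ← (dn_lt_iff_up_le hL hk o).not, not_lt]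

/-- **No Jordan–Wigner string between the two orbitals of a dimer**: if `(k,↓)` is empty, the signs
at `(k,↓)` and `(k+e₂,↑)` agree. [folklore] -/
theorem jwSign_up_eq_jwSign_dn (hL : Even L) {k : TorusSite 2 L} (hk : k ∈ dimerSlots L)
    {t : Finset (Orb (FermionTorus 2 L))} (ht : D[k] ∉ t) : jwSign U[k] t = jwSign D[k] t := by
  unfold jwSign
  congr 1
  congr 1
  refine Finset.filter_congr fun o ho => ?_
  rw [lt_up_iff_le_dn hL hk, le_iff_lt_or_eq]
  constructor
  · rintro (h | rfl)
    · exact h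
    · exact absurd ho ht
  · exact Or.inl

/-! ### Dimer configurations -/

/-- `FermionTorus.ofTorusSite` is injective. [folklore] -/
theorem ofTorusSite_injective :
    Function.Injective (FermionTorus.ofTorusSite : TorusSite 2 L → FermionTorus 2 L) :=
  fun x y h => by simpa using congrArg FermionTorus.toTorusSite h

/-- The shift-and-embed map `k ↦ (k + e₂ : FermionTorus)` is injective. [folklore] -/
theorem shift_injective :
    Function.Injective (fun k : TorusSite 2 L => FermionTorus.ofTorusSite (k + Torus.proj L 𝐞)) :=
  fun _ _ h => add_right_cancel (ofTorusSite_injective h)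

/-- The occupied orbitals of the dimer configuration `S`: a down electron at every `k ∈ S` and an
up electron at every `k + e₂`, `k ∈ S`. -/
def dimerConfig (S : Finset (TorusSite 2 L)) : Finset (Orb (FermionTorus 2 L)) :=
  pairSet (S.image fun k => FermionTorus.ofTorusSite (k + Torus.proj L 𝐞))
    (S.image FermionTorus.ofTorusSite)

/-- The down orbital `(x,↓)` is occupied in `dimerConfig S` iff `x ∈ S`. [folklore] -/
theorem dn_mem_dimerConfig (S : Finset (TorusSite 2 L)) (x : TorusSite 2 L) :
    D[x] ∈ dimerConfig S ↔ x ∈ S := by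
  rw [dimerConfig, orb_one_mem_pairSet]
  exact ofTorusSite_injective.mem_finset_image

/-- The up orbital `(x+e₂,↑)` is occupied in `dimerConfig S` iff `x ∈ S`. [folklore] -/
theorem up_mem_dimerConfig (S : Finset (TorusSite 2 L)) (x : TorusSite 2 L) :
    U[x] ∈ dimerConfig S ↔ x ∈ S := by
  rw [dimerConfig, orb_zero_mem_pairSet]
  exact shift_injective.mem_finset_image

/-- Up-orbital membership for a general site. [folklore] -/
theorem orb_zero_mem_dimerConfig (S : Finset (TorusSite 2 L)) (z : TorusSite 2 L) :
    orb (FermionTorus.ofTorusSite z) 0 ∈ dimerConfig S ↔ z - Torus.proj L 𝐞 ∈ S := by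
  rw [← up_mem_dimerConfig S (z - Torus.proj L 𝐞), sub_add_cancel]

/-- A down orbital is not an up orbital. [folklore] -/
theorem dn_ne_orb_zero (x : TorusSite 2 L) (z : FermionTorus 2 L) : D[x] ≠ orb z 0 := by
  rw [Ne, orb_inj]; simp

/-- `(x,↓) ≠ (y+e₂,↑)`. [folklore] -/
theorem dn_ne_up (x y : TorusSite 2 L) : D[x] ≠ U[y] := dn_ne_orb_zero x _

/-- `(x+e₂,↑) ≠ (y,↓)`. [folklore] -/
theorem up_ne_dn (x y : TorusSite 2 L) : U[x] ≠ D[y] := by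
  rw [Ne, orb_inj]; simp

/-- `(x,↓) = (y,↓) ↔ x = y`. [folklore] -/
theorem dn_eq_dn_iff (x y : TorusSite 2 L) : D[x] = D[y] ↔ x = y := by
  rw [orb_inj, ofTorusSite_injective.eq_iff]; simp

/-- `(x+e₂,↑) = (y+e₂,↑) ↔ x = y`. [folklore] -/
theorem up_eq_up_iff (x y : TorusSite 2 L) : U[x] = U[y] ↔ x = y := by
  rw [orb_inj, shift_injective.eq_iff]; simp

/-- Adding a dimer adds its two orbitals. [folklore] -/
theorem dimerConfig_insert (x : TorusSite 2 L) (T : Finset (TorusSite 2 L)) :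
    dimerConfig (insert x T) = insert U[x] (insert D[x] (dimerConfig T)) := by
  ext i
  rcases orb_cases i with h | h <;> rw [h]
  · rw [mem_insert, mem_insert, dimerConfig, dimerConfig, orb_zero_mem_pairSet,
      orb_zero_mem_pairSet, Finset.image_insert, mem_insert, orb_inj, orb_inj]
    simp
  · rw [mem_insert, mem_insert, dimerConfig, dimerConfig, orb_one_mem_pairSet,
      orb_one_mem_pairSet, Finset.image_insert, mem_insert, orb_inj, orb_inj]
    simp

/-- `dimerConfig` is injective. [folklore] -/
theorem dimerConfig_injective :
    Function.Injective (dimerConfig : Finset (TorusSite 2 L) → Finset (Orb (FermionTorus 2 L))) :=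
  fun _ _ h => Finset.image_injective ofTorusSite_injective (pairSet_injective h).2

/-- A dimer configuration determines its slot set through the down orbitals. [folklore] -/
theorem eq_insert_of_dimerConfig_eq {S T : Finset (TorusSite 2 L)} {x : TorusSite 2 L}
    {q : Orb (FermionTorus 2 L)} (hq : ∀ y : TorusSite 2 L, D[y] ≠ q)
    (h : dimerConfig S = insert q (insert D[x] (dimerConfig T))) : S = insert x T := by
  ext y
  rw [mem_insert, ← dn_mem_dimerConfig S y, h, mem_insert, mem_insert, dn_mem_dimerConfig,
    dn_eq_dn_iff]
  simp [hq y]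

/-- A dimer configuration on `S` has `#S` up electrons. [folklore] -/
theorem up_card_dimerConfig (S : Finset (TorusSite 2 L)) :
    (upPart (dimerConfig S)).card = S.card := by
  rw [dimerConfig, upPart_pairSet, Finset.card_image_of_injective _ shift_injective]

/-- A dimer configuration on `S` has `#S` down electrons. [folklore] -/
theorem dn_card_dimerConfig (S : Finset (TorusSite 2 L)) :
    (downPart (dimerConfig S)).card = S.card := by
  rw [dimerConfig, downPart_pairSet, Finset.card_image_of_injective _ ofTorusSite_injective]

/-- **Gutzwiller constraint**: no site of a dimer configuration over slots is doubly occupied.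
[folklore] -/
theorem not_double (hL : Even L) {S : Finset (TorusSite 2 L)} (hS : S ⊆ dimerSlots L)
    (x : FermionTorus 2 L) : ¬ (orb x 0 ∈ dimerConfig S ∧ orb x 1 ∈ dimerConfig S) := by
  rintro ⟨h0, h1⟩
  rw [← FermionTorus.ofTorusSite_toTorusSite x] at h0 h1
  rw [orb_zero_mem_dimerConfig] at h0
  rw [dn_mem_dimerConfig] at h1
  exact sub_e2_not_mem hL (hS h1) (hS h0)

end Summit.HubbardSuperconductivity.HubbardSuperconductivity.Theorems.DimerCondensate
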